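import Mathlib
import Summits.ValiantsHypothesis.ValiantsHypothesis.Theorems.NewtonUnitEquationsNewtonTauWeakCornerWords

/-!
# `NewtonTauWeak` (stmt-ValiantsHypothesis-5904), stub `fixedKCoincidence_t2_K3`: the ray lemma (`K = 2`) in word form

Helper file of the proof of the `K = 3` sub-stub `fixedKCoincidence_t2_K3` of `stub_binomialNewtonTauCommon`
(line `binomial-normal-form`; siege variation "polynomial identity route"), in the word-box language of the
corner model (`…CornerDefs.lean`: `wt`, `push`, `OnRay`, `sepCoeff`, `box`, `IsOrder`, `Active`; directions
`E_e` of positive weight for a weight injective on `ℤ²`, pairwise non-parallel rays).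

* `ray_lemma` (`K = 2`, all coincidences allowed): for two separated products `⊗U`, `⊗W` with constant terms `1`,
  the `w`-lightest point where the fibre sums of `⊗U - ⊗W` do not cancel is the ORDER POINT `o • E_⋆` of the
  lightest direction, `o = ord(U_⋆ - W_⋆)`: every word whose two separated coefficients differ has a letter beyond
  the order of its direction.
* `weight_ge_lightest_offstar`: the weight bound for words with a letter off a distinguished direction `⋆`
  (used by the shifted corner lemma of `…K3PiShifted.lean`).

No definitions. [folklore]
-/

set_option linter.dupNamespace false

noncomputable section

open scoped BigOperators Polynomial

namespace Summit.ValiantsHypothesis.ValiantsHypothesis.Theorems.NewtonUnitEquationsNewtonTauWeak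

open Summit.ValiantsHypothesis.ValiantsHypothesis.Theorems.NewtonTauWeakCorner

namespace K3Pi

/-! ## Words: letters bound the weight from below -/

/-- Separated coefficients agree when all letters see equal univariate coefficients. [folklore] -/
theorem sepCoeff_congr {s : ℕ} {U W : Fin s → ℂ[X]} {n : Fin s → ℕ}
    (h : ∀ e, (U e).coeff (n e) = (W e).coeff (n e)) : sepCoeff U n = sepCoeff W n := by
  unfold sepCoeff
  exact Finset.prod_congr rfl fun e _ => h e

/-- **One letter bounds the weight**: for directions of positive weight, a word weighs at least its letter `e₀`
times the weight of `E_{e₀}`, with equality only for the pure power word. [folklore] -/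
theorem letter_le_wt_push {s : ℕ} (E : Fin s → Fin 2 → ℤ) (w : Fin 2 → ℝ) (hw : ∀ e, 0 < wt w (E e))
    (n : Fin s → ℕ) (e₀ : Fin s) :
    (n e₀ : ℝ) * wt w (E e₀) ≤ wt w (push E n) ∧
      ((n e₀ : ℝ) * wt w (E e₀) = wt w (push E n) → n = Pi.single e₀ (n e₀)) := by
  classical
  have hnn : ∀ e, 0 ≤ (n e : ℝ) * wt w (E e) := fun e => mul_nonneg (Nat.cast_nonneg _) (hw e).le
  have hsplit : wt w (push E n) = (n e₀ : ℝ) * wt w (E e₀) + ∑ e ∈ Finset.univ.erase e₀, (n e : ℝ) * wt w (E e) := by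
    rw [wt_push, ← Finset.add_sum_erase _ _ (Finset.mem_univ e₀)]
  have hrest : 0 ≤ ∑ e ∈ Finset.univ.erase e₀, (n e : ℝ) * wt w (E e) := Finset.sum_nonneg fun e _ => hnn e
  refine ⟨by rw [hsplit]; linarith, fun heq => ?_⟩
  rw [hsplit] at heq
  have h0 : ∑ e ∈ Finset.univ.erase e₀, (n e : ℝ) * wt w (E e) = 0 := by linarith
  have hall := (Finset.sum_eq_zero_iff_of_nonneg fun e _ => hnn e).mp h0
  funext x
  by_cases hx : x = e₀
  · subst hx; simp
  · have := hall x (Finset.mem_erase.mpr ⟨hx, Finset.mem_univ x⟩)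
    rcases mul_eq_zero.mp this with h1 | h1
    · have : n x = 0 := by exact_mod_cast h1
      simp [hx, this]
    · exact absurd h1 (hw x).ne'

/-- Identification of a direction and a multiplicity from an equality of weighted multiples. [folklore] -/
theorem eq_of_wt_smul_eq {s : ℕ} (E : Fin s → Fin 2 → ℤ) (w : Fin 2 → ℝ) (hw : ∀ e, 0 < wt w (E e))
    (hgen : Function.Injective (wt w))
    (hE : ∀ e e' : Fin s, ∀ k k' : ℕ, 1 ≤ k → (k : ℤ) • E e = (k' : ℤ) • E e' → e = e')
    {e e' : Fin s} {k k' : ℕ} (hk : 1 ≤ k) (h : (k : ℝ) * wt w (E e) = (k' : ℝ) * wt w (E e')) :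
    e = e' ∧ k = k' := by
  have h' : wt w ((k : ℤ) • E e) = wt w ((k' : ℤ) • E e') := by
    rw [wt_zsmul, wt_zsmul]; push_cast; exact h
  have hpt := hgen h'
  have hee : e = e' := hE e e' k k' hk hpt
  subst hee
  refine ⟨rfl, ?_⟩
  have := mul_right_cancel₀ (hw e).ne' h
  exact_mod_cast this

/-! ## The ray lemma (`K = 2`) -/

/-- **RAY LEMMA.** Two separated products `⊗U`, `⊗W` (`U_e(0) = W_e(0) = 1`, degrees `≤ D`) over directions of
positive weight; `o = ord(U_⋆ - W_⋆)` and the order point `o • E_⋆` is (weakly) the lightest among all order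
points `ord(U_e - W_e) • E_e`.  Then the fibre sums of `⊗U - ⊗W` vanish at every point lighter than `o • E_⋆`,
and at `o • E_⋆` the fibre sum is `[s^o](U_⋆ - W_⋆) ≠ 0`. [folklore; the `K = 2` telescoping/ray lemma of
`Cruxes/NewtonTauWeak/NOTES.md` §3 in word form] -/
theorem ray_lemma {s D : ℕ} (E : Fin s → Fin 2 → ℤ) (w : Fin 2 → ℝ)
    (hw : ∀ e, 0 < wt w (E e)) (hgen : Function.Injective (wt w))
    (hE : ∀ e e' : Fin s, ∀ k k' : ℕ, 1 ≤ k → (k : ℤ) • E e = (k' : ℤ) • E e' → e = e')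
    (U W : Fin s → ℂ[X]) (hU0 : ∀ e, (U e).coeff 0 = 1) (hW0 : ∀ e, (W e).coeff 0 = 1)
    (star : Fin s) (o : ℕ) (ho : IsOrder (U star - W star) o)
    (hmin : ∀ e k, IsOrder (U e - W e) k → (o : ℝ) * wt w (E star) ≤ (k : ℝ) * wt w (E e)) :
    (∑ n ∈ (box s D).filter (fun n => push E n = (o : ℤ) • E star), (sepCoeff U n - sepCoeff W n) =
        (if o ≤ D then (U star).coeff o - (W star).coeff o else 0)) ∧
      ∀ z, wt w z < (o : ℝ) * wt w (E star) →
        ∑ n ∈ (box s D).filter (fun n => push E n = z), (sepCoeff U n - sepCoeff W n) = 0 := by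
  classical
  -- KEY: a word whose separated coefficients differ weighs at least the lightest order point, with equality only
  -- for the pure word `o • [⋆]`
  have key : ∀ n : Fin s → ℕ, sepCoeff U n ≠ sepCoeff W n →
      (o : ℝ) * wt w (E star) ≤ wt w (push E n) ∧
        ((o : ℝ) * wt w (E star) = wt w (push E n) → n = Pi.single star o) := by
    intro n hne
    -- a letter where the univariate coefficients differ
    obtain ⟨e, he⟩ : ∃ e, (U e).coeff (n e) ≠ (W e).coeff (n e) := by
      by_contra hall
      push Not at hall
      exact hne (sepCoeff_congr hall)
    have hdiff : (U e - W e).coeff (n e) ≠ 0 := by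
      rw [Polynomial.coeff_sub]; exact sub_ne_zero.mpr he
    have hne0 : n e ≠ 0 := by
      intro h0
      rw [h0] at he
      exact he (by rw [hU0, hW0])
    have h1 : 1 ≤ n e := Nat.one_le_iff_ne_zero.mpr hne0
    obtain ⟨k, hk⟩ := exists_isOrder ⟨n e, h1, hdiff⟩
    have hkle : k ≤ n e := hk.le_of_coeff_ne_zero h1 hdiff
    have i1 := hmin e k hk
    have i2 : (k : ℝ) * wt w (E e) ≤ (n e : ℝ) * wt w (E e) :=
      mul_le_mul_of_nonneg_right (by exact_mod_cast hkle) (hw e).le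
    have i3 := letter_le_wt_push E w hw n e
    refine ⟨by linarith [i3.1], fun heq => ?_⟩
    have e1 : (o : ℝ) * wt w (E star) = (k : ℝ) * wt w (E e) := by linarith [i3.1]
    have e3 : (n e : ℝ) * wt w (E e) = wt w (push E n) := by linarith [i3.1]
    obtain ⟨hse, hok⟩ := eq_of_wt_smul_eq E w hw hgen hE ho.1 e1
    subst hse
    have hkn : k = n star := by
      have e2 : (k : ℝ) * wt w (E star) = (n star : ℝ) * wt w (E star) := by linarith
      have := mul_right_cancel₀ (hw star).ne' e2
      exact_mod_cast this
    rw [i3.2 e3, ← hkn, hok]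
  refine ⟨?_, fun z hz => ?_⟩
  · -- at the order point: only the pure word contributes
    by_cases hoD : o ≤ D
    · rw [if_pos hoD, Finset.sum_eq_single_of_mem (Pi.single star o)]
      · rw [sepCoeff_single U hU0, sepCoeff_single W hW0]
      · exact Finset.mem_filter.mpr ⟨single_mem_box star hoD, push_single E star o⟩
      · intro n hn hns
        by_contra hne
        have hne' : sepCoeff U n ≠ sepCoeff W n := fun h => hne (by rw [h, sub_self])
        have hpush : push E n = (o : ℤ) • E star := (Finset.mem_filter.mp hn).2
        have heq : (o : ℝ) * wt w (E star) = wt w (push E n) := by rw [hpush, wt_zsmul]; push_cast; ring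
        exact hns ((key n hne').2 heq)
    · rw [if_neg hoD]
      refine Finset.sum_eq_zero fun n hn => ?_
      by_contra hne
      have hne' : sepCoeff U n ≠ sepCoeff W n := fun h => hne (by rw [h, sub_self])
      have hpush : push E n = (o : ℤ) • E star := (Finset.mem_filter.mp hn).2
      have heq : (o : ℝ) * wt w (E star) = wt w (push E n) := by rw [hpush, wt_zsmul]; push_cast; ring
      have hns := (key n hne').2 heq
      have hbox : n ∈ box s D := (Finset.mem_filter.mp hn).1
      rw [hns] at hbox
      simp only [box, Fintype.mem_piFinset, Finset.mem_range] at hbox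
      have := hbox star
      simp at this
      omega
  · -- below the order point every word has equal separated coefficients
    refine Finset.sum_eq_zero fun n hn => ?_
    by_contra hne
    have hne' : sepCoeff U n ≠ sepCoeff W n := fun h => hne (by rw [h, sub_self])
    have hpush : push E n = z := (Finset.mem_filter.mp hn).2
    have := (key n hne').1
    rw [hpush] at this
    linarith

/-! ## The shifted corner lemma (`K = 3`, two products at the corner) -/

/-- **Weight bound for shifted words.** Let `oB` give the orders of the active factors of `B`, and let `b ≠ ⋆`
minimise `oB_e ⟨w,E_e⟩` over the active directions `e ≠ ⋆`.  Then every word with nonzero separated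
`B`-coefficient and a nonzero letter off `⋆` weighs at least `oB_b ⟨w,E_b⟩`, with equality only for the pure
word `oB_b • [b]`. [folklore] -/
theorem weight_ge_lightest_offstar {s : ℕ} (E : Fin s → Fin 2 → ℤ) (w : Fin 2 → ℝ)
    (hw : ∀ e, 0 < wt w (E e)) (hgen : Function.Injective (wt w))
    (hE : ∀ e e' : Fin s, ∀ k k' : ℕ, 1 ≤ k → (k : ℤ) • E e = (k' : ℤ) • E e' → e = e')
    (B : Fin s → ℂ[X]) (oB : Fin s → ℕ) (hoB : ∀ e, Active (B e) → IsOrder (B e) (oB e))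
    (star b : Fin s) (hb : Active (B b))
    (hbmin : ∀ e, e ≠ star → Active (B e) → (oB b : ℝ) * wt w (E b) ≤ (oB e : ℝ) * wt w (E e))
    (n : Fin s → ℕ) (hn : sepCoeff B n ≠ 0) (e₀ : Fin s) (he₀ : e₀ ≠ star) (hne₀ : n e₀ ≠ 0) :
    (oB b : ℝ) * wt w (E b) ≤ wt w (push E n) ∧
      ((oB b : ℝ) * wt w (E b) = wt w (push E n) → n = Pi.single b (oB b)) := by
  have h1 : 1 ≤ n e₀ := Nat.one_le_iff_ne_zero.mpr hne₀
  have hc : (B e₀).coeff (n e₀) ≠ 0 := sepCoeff_ne_zero_apply hn e₀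
  have hA : Active (B e₀) := active_of_coeff_ne_zero h1 hc
  have hole : oB e₀ ≤ n e₀ := (hoB e₀ hA).le_of_coeff_ne_zero h1 hc
  have i1 := hbmin e₀ he₀ hA
  have i2 : (oB e₀ : ℝ) * wt w (E e₀) ≤ (n e₀ : ℝ) * wt w (E e₀) :=
    mul_le_mul_of_nonneg_right (by exact_mod_cast hole) (hw e₀).le
  have i3 := letter_le_wt_push E w hw n e₀
  refine ⟨by linarith [i3.1], fun heq => ?_⟩
  have e1 : (oB b : ℝ) * wt w (E b) = (oB e₀ : ℝ) * wt w (E e₀) := by linarith [i3.1]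
  have e3 : (n e₀ : ℝ) * wt w (E e₀) = wt w (push E n) := by linarith [i3.1]
  obtain ⟨hbe, hok⟩ := eq_of_wt_smul_eq E w hw hgen hE (hoB b hb).1 e1
  subst hbe
  have hkn : oB b = n b := by
    have e2 : (oB b : ℝ) * wt w (E b) = (n b : ℝ) * wt w (E b) := by linarith
    have := mul_right_cancel₀ (hw b).ne' e2
    exact_mod_cast this
  rw [i3.2 e3, ← hkn]


end K3Pi

end Summit.ValiantsHypothesis.ValiantsHypothesis.Theorems.NewtonUnitEquationsNewtonTauWeak

end
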